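import Literature.NumberTheory.LFunctions.WeilCriterionConverse
import Literature.NumberTheory.LFunctions.WeilExplicitFormulaProofs
import Literature.NumberTheory.LFunctions.UniformWeilPositivityRH
import Literature.NumberTheory.LFunctions.WeilSmallSupportPositivity
import Literature.Analysis.Complex.BoundedPowerSums
import Literature.NumberTheory.LFunctions.WeilMarkovQuadratic
import Literature.NumberTheory.LFunctions.WeilArchimedeanPositivityProofs
import Literature.NumberTheory.LFunctions.WeilMellinBounds
import Literature.NumberTheory.LFunctions.WeilCriterionProofs
import Literature.NumberTheory.LFunctions.WeilWindowSimpleEven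
import Literature.NumberTheory.LFunctions.WeilGroundEnergyProofs
import Literature.NumberTheory.ConnesConsani2019.RiemannRochStrategy
import Literature.NumberTheory.LFunctions.WeilWindowSuzukiContinuityProofs
import HarnessLib

/-!
# Weil's criterion in pole-free form (Bombieri 2000 Thms. 1–2) and Connes–Consani 2019 eq. (15) — `ConnesConsani2019.eq15` HOLDS (re-homed proofs)

**Weil's criterion in pole-free form and Connes–Consani 2019 eq. (15)**: `RiemannHypothesis ⟺ Re W(g ⋆ g̃) ≥ 0` for every
smooth compactly supported `g` with `ĝ(0) = ĝ(1) = 0` (E. Bombieri, *Remarks on Weil's quadratic functional in the theory of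
prime numbers I*, Rend. Mat. Acc. Lincei (9) 11 (2000), Thm. 1 pp. 189–190, Thm. 2 p. 193 [Bombieri2000Weil]; A. Weil 1952
[Weil1952]) — Bombieri's converse run inside any dipole-stable zero-detecting class of tests (`riemannHypothesis_of_stable_class`),
the pole killer `φ ↦ φ'' − φ/4`, the reduction to real-valued tests `Q(u + iv) = Q(u) + Q(v)` — and hence the named fact
`Literature.NumberTheory.ConnesConsani2019.eq15` (`RiemannRochStrategy.lean`: A. Connes, C. Consani, *The Riemann–Roch strategy*,
arXiv:1805.10501, §3.1 eq. (15) [ConnesConsani2019RiemannRochStrategy]: `RH ⟺ 𝔰(f,f) ≤ 0` for all real tests with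
`∫ f d^*u = ∫ f du = 0`), EXACT discharge `Literature.NumberTheory.ConnesConsani2019.eq15_holds`.  RE-HOMED into `Literature/`
by the Hodge foundations lane (`lit-hodgefound`, seat p20, generation 37): verbatim DECLARATION-LEVEL ports (the declarations needed,
in dependency order, each with a route-neutralised module docstring) of `Summits/RiemannHypothesis/RiemannHypothesis/Theorems/
{WeilCombCombShapeDetection (3 declarations), SoloInformedPoleFree (10), SoloInformedScrewRayleigh (1), SoloInformedWeilSurface (5),
MotivicDoorCC2019Criterion}.lean`, namespace `Summit.RiemannHypothesis.RiemannHypothesis.Theorems` re-rooted as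
`Literature.NumberTheory.LFunctions.WeilPoleFree` (the summit's `RiemannHypothesis` is DEFINITIONALLY Mathlib's
`RiemannHypothesis`, `Summit.RiemannHypothesis_iff := Iff.rfl`; here Mathlib's statement is used directly).  Built on the tree's
Literature layer `Literature/NumberTheory/LFunctions/` (`WeilCriterionConverse`, `WeilCriterionProofs` — `weil_criterion_holds` —,
`WeilExplicitFormulaProofs`, `BoundedPowerSums`, `WeilMellinBounds`, `WeilWindowSimpleEven`, `WeilGroundEnergyProofs`,
`WeilWindowSuzukiContinuityProofs`, `UniformWeilPositivityRH`, …) and `Literature/NumberTheory/ConnesConsani2019/RiemannRochStrategy.lean` (the normalisation dictionary).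
Theorem-only file: no definition, no new named fact (D-0026); imports Mathlib/Literature only; every declaration carries the citation
of the printed statement it formalises or serves.  The Summits originals stay in place (transitional duplication; twins = same short
names).  WHAT THIS IS NOT: every statement here is an EQUIVALENT reformulation of RH or a lemma about Weil's functional; nothing
here bears on the truth of the Riemann Hypothesis.
-/

noncomputable section

/-!
## Part 1 — port of `Summits/RiemannHypothesis/RiemannHypothesis/Theorems/WeilCombCombShapeDetection.lean` (3 declarations kept)

# The zero form of Weil's functional and the bounded-exponential-series detection (three lemmas)

From the source module (the in-tree converse half of Weil's criterion,
`Literature/NumberTheory/LFunctions/WeilCriterionConverse.lean`, rerun on two-node combs) we keep: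
* `combShapeDetection_zeroForm_eq_weilQuadratic` — `Q(g)` is the absolutely convergent zero form
  `Σ_ρ m(ρ) ĝ(ρ) conj ĝ(1 − ρ̄)` (`explicit_formula_holds`, `WeilConverse.hasWeilZeroSide_zeroForm`, uniqueness of limits);
* `combShapeDetection_norm_expSum_le_of_translateMix` — the polarisation identity `WeilConverse.zeroForm_translateMix` yields
  `‖B_g(x)‖ ≤ Re Q(g)` for the exponential series `B_g = WeilConverse.expSum g` whenever `Re Q ≥ 0` on the dipoles `g + c·g(· − x)`;
* `combShapeDetection_order_mul_pairCoeff_eq_zero` — a bounded exponential series with locally finite exponents has no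
  terms off the imaginary axis (`BoundedPowerSum.sum_fiber_eq_zero_of_exp_real`): `m(ρ) P_g(ρ) = 0` whenever `Re ρ ≠ 1/2`.

References: E. Bombieri, *Remarks on Weil's quadratic functional in the theory of prime numbers I*, Rend. Lincei (9) 11
(2000), §3 Thm. 1 [Bombieri2000Weil]; A. Weil (1952) [Weil1952].
-/

section Part1

-- `Summit.RiemannHypothesis.RiemannHypothesis.…` duplicates `RiemannHypothesis` BY DESIGN (D-0017, single-problem
open scoped _root_.BigOperators ComplexConjugate _root_.ContDiff _root_.Real _root_.Topology
open _root_.Complex _root_.MeasureTheory _root_.Set _root_.Filter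

namespace Literature.NumberTheory.LFunctions.WeilPoleFree

open Literature.NumberTheory.LFunctions
open Literature.NumberTheory.LFunctions.WeilConverse

/-! ## Generic facts about the zero form of a Weil test -/

/-- For a Weil test `g` the zero form `Σ_ρ m(ρ) ĝ(ρ) conj ĝ(1 − ρ̄)` equals `Q(g) = W(g ⋆ g̃)`:
both are limits of the symmetric partial zero sums of `g ⋆ g̃` (`hasWeilZeroSide_zeroForm`,
`explicit_formula_holds`). [cite: Bombieri2000, Thm 2] -/
theorem combShapeDetection_zeroForm_eq_weilQuadratic {g : ℝ → ℂ} (hg : IsWeilTest g) :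
    zeroForm g = weilQuadratic g :=
  tendsto_nhds_unique (hasWeilZeroSide_zeroForm hg)
    (explicit_formula_holds (hg.weilConv hg.weilReflect))

/-- Polarisation at ONE shift `x`: if `Re Q(g) ≥ 0` and `Re Q(g + c·g(· − x)) ≥ 0` for every
`c : ℂ`, then `‖B_g(x)‖ ≤ Re Q(g)` (choose `c = −conj B_g(x)/‖B_g(x)‖` in
`zeroForm_translateMix`; the proof of `WeilConverse.norm_expSum_le` with its hypothesis
localised). [cite: Bombieri2000Weil, §3 Thm. 1 (the zero form of Q, polarisation ‖B_g(x)‖ ≤ Re Q(g), bounded exponential series have no term off the line)] -/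
theorem combShapeDetection_norm_expSum_le_of_translateMix {g : ℝ → ℂ} (hg : IsWeilTest g)
    {x : ℝ} (hQ : 0 ≤ (zeroForm g).re)
    (hx : ∀ c : ℂ, 0 ≤ (zeroForm (translateMix g c x)).re) :
    ‖expSum g x‖ ≤ (zeroForm g).re := by
  set B := expSum g x with hBdef
  by_cases hB : B = 0
  · rw [hB, norm_zero]; exact hQ
  have hA : expSum' g x = conj B := by
    rw [hBdef, ← conj_expSum' g x, Complex.conj_conj]
  have hn0 : ‖B‖ ≠ 0 := norm_ne_zero_iff.2 hB
  have hn : (‖B‖ : ℂ) ≠ 0 := by exact_mod_cast hn0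
  set c : ℂ := -conj B / (‖B‖ : ℂ) with hc
  have hcB : c * B = -(‖B‖ : ℂ) := by
    rw [hc, div_mul_eq_mul_div, neg_mul, Complex.conj_mul', neg_div]
    congr 1
    rw [sq, mul_div_assoc, div_self hn, mul_one]
  have hc1 : Complex.normSq c = 1 := by
    rw [Complex.normSq_eq_norm_sq, hc, norm_div, norm_neg, Complex.norm_conj, Complex.norm_real,
      Real.norm_eq_abs, abs_norm, div_self hn0, one_pow]
  have h0 := hx c
  rw [zeroForm_translateMix hg c x, hA, ← map_mul, hcB, hc1] at h0
  simp only [map_neg, Complex.conj_ofReal, Complex.ofReal_one, one_mul, add_re, neg_re,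
    Complex.ofReal_re] at h0
  linarith

/-- No terms off the line: if `‖B_g(x)‖ ≤ Q` for all real `x` then `m(ρ₀) P_g(ρ₀) = 0` for every
non-trivial zero `ρ₀` with `Re ρ₀ ≠ 1/2` (`BoundedPowerSum.sum_fiber_eq_zero_of_exp_real` with
exponents `ρ − 1/2`, locally finite; the fibre over `ρ₀ − 1/2` is `{ρ₀}`; as in
`WeilConverse.order_mul_pairCoeff_eq_zero`). [cite: Bombieri2000Weil, §3 Thm. 1 (the zero form of Q, polarisation ‖B_g(x)‖ ≤ Re Q(g), bounded exponential series have no term off the line)] -/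
theorem combShapeDetection_order_mul_pairCoeff_eq_zero {g : ℝ → ℂ} (hg : IsWeilTest g) {Q : ℝ}
    (hB : ∀ x : ℝ, ‖expSum g x‖ ≤ Q) {ρ₀ : ℂ}
    (hρ₀ : ρ₀ ∈ ZetaZeros.riemannZetaNontrivialZeros) (hre : ρ₀.re ≠ 1 / 2) :
    (riemannZetaZeroOrder ρ₀ : ℂ) * pairCoeff g ρ₀ = 0 := by
  have h := Literature.Analysis.Complex.BoundedPowerSum.sum_fiber_eq_zero_of_exp_real
    (ι := ZetaZeros.riemannZetaNontrivialZeros)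
    (c := fun ρ ↦ (riemannZetaZeroOrder (ρ : ℂ) : ℂ) * pairCoeff g ρ)
    (lam := fun ρ ↦ (ρ : ℂ) - 1 / 2) (R := 1 / 2) (M := Q)
    (summable_norm_pairCoeff hg) (fun ρ ↦ abs_re_sub_half_le ρ.2) (fun z ↦ ?_)
    (fun x ↦ hB x) (μ := ρ₀ - 1 / 2) (by simpa [sub_re] using sub_ne_zero.2 hre)
    {⟨ρ₀, hρ₀⟩} (fun ρ ↦ ?_)
  · simpa using h
  · refine ⟨1, one_pos, ?_⟩
    refine ((riemannZetaNontrivialZeros_finite_inter_ball (z + 1 / 2) 1).preimage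
      (Subtype.val_injective.injOn)).subset fun ρ hρ ↦ ?_
    simp only [mem_setOf_eq, Metric.mem_ball, dist_eq_norm] at hρ
    refine ⟨ρ.2, ?_⟩
    rw [Metric.mem_ball, dist_eq_norm]
    rwa [show (ρ : ℂ) - (z + 1 / 2) = (ρ : ℂ) - 1 / 2 - z by ring]
  · rw [Finset.mem_singleton, sub_left_inj]
    constructor
    · rintro rfl; rfl
    · intro h; exact Subtype.ext h

/-! ## The fixed bump `φ_ε(t) = ε⁻¹ expNegInvGlue (1 − (t/ε)²)` -/

end Literature.NumberTheory.LFunctions.WeilPoleFree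

end Part1

/-!
## Part 2 — port of `Summits/RiemannHypothesis/RiemannHypothesis/Theorems/SoloInformedPoleFree.lean` (10 declarations kept)

# The pole-free form of Weil's criterion

Weil's hermitian form `Q(g) = W(g ⋆ g̃)` (`weilQuadratic`) carries the polar term
`k̂(0) + k̂(1) = 2 Re(ĝ(0) conj ĝ(1))` of `k = g ⋆ g̃`, a form of signature `(1,1)`
(`weilPoleForm`). On the **pole-free** test functions — `ĝ(0) = ĝ(1) = 0`, i.e.
`g ⊥ e^{t/2}, e^{-t/2}`, a subspace of codimension two in every window, stable under translation
and under the dipoles `g + c·g(· − x)` of Bombieri's proof — the polar term vanishes identically.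

* `riemannHypothesis_of_stable_class`: Bombieri's converse (Bombieri 2000, Thm. 1, "if") runs
  inside ANY class of test functions stable under the dipoles `g ↦ g + c·g(· − x)` whose members
  detect every non-trivial zero (`P_g(ρ) ≠ 0` for some member): positivity of `Re Q` on the class
  gives the Riemann hypothesis (Mathlib's `RiemannHypothesis`).
* `riemannHypothesis_iff_poleFree`: **`RH ⟺ Re Q(g) ≥ 0` for every pole-free test `g`**
  (no side condition is lost: `(φ'' − φ/4)^(s) = s(s−1) φ̂(s)` kills both poles, `weilMellin_poleKill`,
  and detects every zero, `exists_pairCoeff_poleKill_ne_zero`);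
* `weilPoleForm_eq_zero_of_poleFree`.

A reformulation of RH, not progress on it.  References: E. Bombieri, *Remarks on Weil's quadratic functional in the
theory of prime numbers I*, Rend. Mat. Acc. Lincei (9) 11 (2000) 183–233, Thm. 1 (pp. 189–190) and Thm. 2 (p. 193)
[Bombieri2000Weil]; H. Yoshida, *On Hermitian forms attached to zeta functions*, Adv. Stud. Pure Math. 21 (1992), §6.
-/

section Part2

open _root_.Complex _root_.Filter _root_.Set _root_.MeasureTheory
open scoped _root_.Real _root_.Topology ComplexConjugate ArithmeticFunction.vonMangoldt

namespace Literature.NumberTheory.LFunctions.WeilPoleFree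

open Literature.NumberTheory.LFunctions Literature.NumberTheory.LFunctions.WeilConverse

/-! ## Bombieri's converse inside a dipole-stable class -/

/-- **Zeros on the line from positivity on a dipole-stable class.** If `P` is stable under the
dipoles `g ↦ g + c·g(· − x)`, `Re Q ≥ 0` on the tests in `P` (zero-side form `zeroForm`), and some
test in `P` has `P_g(ρ) ≠ 0`, then `Re ρ = 1/2`: `‖B_g(x)‖ ≤ Re Q(g)` for all real `x` by
polarisation inside the class, and a bounded generalised Dirichlet series has no term off the
imaginary axis. [cite: Bombieri2000Weil, Thm. 1 ("if" half, pp. 189–190)] -/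
theorem re_eq_one_half_of_stable_class {P : (ℝ → ℂ) → Prop}
    (hP : ∀ (g : ℝ → ℂ) (c : ℂ) (x : ℝ), IsWeilTest g → P g → P (translateMix g c x))
    (hQ : ∀ g : ℝ → ℂ, IsWeilTest g → P g → 0 ≤ (zeroForm g).re)
    {ρ : ℂ} (hρ : ρ ∈ ZetaZeros.riemannZetaNontrivialZeros)
    (hdet : ∃ g : ℝ → ℂ, IsWeilTest g ∧ P g ∧ pairCoeff g ρ ≠ 0) : ρ.re = 1 / 2 := by
  by_contra hre
  obtain ⟨g, hg, hPg, hne⟩ := hdet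
  have hB : ∀ x : ℝ, ‖expSum g x‖ ≤ (zeroForm g).re := fun x ↦
    combShapeDetection_norm_expSum_le_of_translateMix hg (hQ g hg hPg)
      fun c ↦ hQ _ (isWeilTest_translateMix hg c x) (hP g c x hg hPg)
  have h := combShapeDetection_order_mul_pairCoeff_eq_zero hg hB hρ hre
  have hm : (riemannZetaZeroOrder ρ : ℂ) ≠ 0 := by
    have := ZetaZeros.riemannZetaNontrivialZeros.one_le_order hρ
    exact_mod_cast (by omega : riemannZetaZeroOrder ρ ≠ 0)
  exact mul_ne_zero hm hne h

/-- **Bombieri's converse inside a dipole-stable, zero-detecting class**: positivity of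
`Re Q(g) = Re W(g ⋆ g̃)` on the tests of a class `P` stable under `g ↦ g + c·g(· − x)` and
containing, for every non-trivial zero `ρ`, a test with `P_g(ρ) ≠ 0`, implies the Riemann
hypothesis (`zeroForm = weilQuadratic` by the explicit formula). [cite: Bombieri2000Weil, Thm. 1] -/
theorem riemannHypothesis_of_stable_class {P : (ℝ → ℂ) → Prop}
    (hP : ∀ (g : ℝ → ℂ) (c : ℂ) (x : ℝ), IsWeilTest g → P g → P (translateMix g c x))
    (H : ∀ g : ℝ → ℂ, IsWeilTest g → P g → 0 ≤ (weilQuadratic g).re)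
    (hdet : ∀ ρ ∈ ZetaZeros.riemannZetaNontrivialZeros,
      ∃ g : ℝ → ℂ, IsWeilTest g ∧ P g ∧ pairCoeff g ρ ≠ 0) :
    RiemannHypothesis := by
  have hQ : ∀ g : ℝ → ℂ, IsWeilTest g → P g → 0 ≤ (zeroForm g).re := fun g hg hPg ↦ by
    rw [combShapeDetection_zeroForm_eq_weilQuadratic hg]
    exact H g hg hPg
  refine riemannHypothesis_iff_strip_holds.2 fun s hs h0 h1 ↦ ?_
  have hρ : s ∈ ZetaZeros.riemannZetaNontrivialZeros :=
    ZetaZeros.riemannZetaNontrivialZeros.mem_iff'.2 ⟨hs, h0, h1⟩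
  exact re_eq_one_half_of_stable_class hP hQ hρ (hdet s hρ)

/-! ## The pole-free class `ĝ(0) = ĝ(1) = 0` and the pole killer `φ ↦ φ'' − φ/4` -/

/-- The pole-free tests (`ĝ(0) = ĝ(1) = 0`) are stable under the dipoles `g + c·g(· − x)`
(`(g + c g_x)^(s) = ĝ(s)(1 + c e^{(s−1/2)x})`). [cite: Bombieri2000Weil, Thm. 1 (pp. 189–190) and Thm. 2 (p. 193) (Weil’s criterion; the pole-free form ĝ(0) = ĝ(1) = 0 and the pole killer φ″ − φ/4)] -/
theorem poleFree_translateMix {g : ℝ → ℂ} (hg : IsWeilTest g)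
    (hp : weilMellin g 0 = 0 ∧ weilMellin g 1 = 0) (c : ℂ) (x : ℝ) :
    weilMellin (translateMix g c x) 0 = 0 ∧ weilMellin (translateMix g c x) 1 = 0 := by
  constructor
  · rw [weilMellin_translateMix hg, hp.1, zero_mul]
  · rw [weilMellin_translateMix hg, hp.2, zero_mul]

/-- `φ'' − φ/4 = (d/dt − 1/2)(d/dt + 1/2) φ` is a test function. [cite: Bombieri2000Weil, Thm. 1 (pp. 189–190) and Thm. 2 (p. 193) (Weil’s criterion; the pole-free form ĝ(0) = ĝ(1) = 0 and the pole killer φ″ − φ/4)] -/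
theorem isWeilTest_poleKill {φ : ℝ → ℂ} (hφ : IsWeilTest φ) :
    IsWeilTest (deriv (deriv φ) - fun t ↦ (4⁻¹ : ℂ) * φ t) :=
  hφ.deriv.deriv.sub (hφ.const_mul _)

/-- `(φ'' − φ/4)^(s) = ((s − 1/2)² − 1/4) φ̂(s) = s(s − 1) φ̂(s)`: the pole killer kills both
poles of the explicit formula. [cite: Bombieri2000Weil, Thm. 1 (pp. 189–190) and Thm. 2 (p. 193) (Weil’s criterion; the pole-free form ĝ(0) = ĝ(1) = 0 and the pole killer φ″ − φ/4)] -/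
theorem weilMellin_poleKill {φ : ℝ → ℂ} (hφ : IsWeilTest φ) (s : ℂ) :
    weilMellin (deriv (deriv φ) - fun t ↦ (4⁻¹ : ℂ) * φ t) s = s * (s - 1) * weilMellin φ s := by
  have hh : IsWeilTest fun t ↦ (4⁻¹ : ℂ) * φ t := hφ.const_mul _
  rw [weilMellin_sub hφ.deriv.deriv.1.continuous hφ.deriv.deriv.2 hh.1.continuous hh.2,
    weilMellin_const_mul, weilMellin_deriv_deriv hφ]
  ring

/-- `φ'' − φ/4` is pole-free. [cite: Bombieri2000Weil, Thm. 1 (pp. 189–190) and Thm. 2 (p. 193) (Weil’s criterion; the pole-free form ĝ(0) = ĝ(1) = 0 and the pole killer φ″ − φ/4)] -/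
theorem poleFree_poleKill {φ : ℝ → ℂ} (hφ : IsWeilTest φ) :
    weilMellin (deriv (deriv φ) - fun t ↦ (4⁻¹ : ℂ) * φ t) 0 = 0 ∧
      weilMellin (deriv (deriv φ) - fun t ↦ (4⁻¹ : ℂ) * φ t) 1 = 0 := by
  constructor <;> rw [weilMellin_poleKill hφ] <;> simp

/-- `P_{φ'' − φ/4}(ρ) = (ρ(ρ − 1))² P_φ(ρ)` (the factor at `1 − ρ̄` is `(1 − ρ̄)(−ρ̄)`, whose
conjugate is again `ρ(ρ − 1)`). [cite: Bombieri2000Weil, Thm. 1 (pp. 189–190) and Thm. 2 (p. 193) (Weil’s criterion; the pole-free form ĝ(0) = ĝ(1) = 0 and the pole killer φ″ − φ/4)] -/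
theorem pairCoeff_poleKill {φ : ℝ → ℂ} (hφ : IsWeilTest φ) (ρ : ℂ) :
    pairCoeff (deriv (deriv φ) - fun t ↦ (4⁻¹ : ℂ) * φ t) ρ =
      (ρ * (ρ - 1)) ^ 2 * pairCoeff φ ρ := by
  rw [pairCoeff, pairCoeff, weilMellin_poleKill hφ, weilMellin_poleKill hφ]
  simp only [map_mul, map_sub, map_one, Complex.conj_conj]
  ring

/-- **Pole-free tests detect every non-trivial zero**: for `ρ` in the open strip there is a test
`φ` with `P_{φ'' − φ/4}(ρ) ≠ 0` (a narrow bump has `Re φ̂ > 0` on the horizontal line through `ρ`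
and `1 − ρ̄`, `exists_isWeilTest_re_weilMellin_pos`, and `ρ ∉ {0, 1}`). [cite: Bombieri2000Weil, Thm. 1 (pp. 189–190) and Thm. 2 (p. 193) (Weil’s criterion; the pole-free form ĝ(0) = ĝ(1) = 0 and the pole killer φ″ − φ/4)] -/
theorem exists_pairCoeff_poleKill_ne_zero {ρ : ℂ}
    (hρ : ρ ∈ ZetaZeros.riemannZetaNontrivialZeros) :
    ∃ φ : ℝ → ℂ, IsWeilTest φ ∧ pairCoeff (deriv (deriv φ) - fun t ↦ (4⁻¹ : ℂ) * φ t) ρ ≠ 0 := by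
  obtain ⟨g, hg, hpos⟩ := exists_isWeilTest_re_weilMellin_pos ρ.im
  refine ⟨g, hg, ?_⟩
  have h0 := ZetaZeros.riemannZetaNontrivialZeros.re_pos hρ
  have h1' := ZetaZeros.riemannZetaNontrivialZeros.re_lt_one hρ
  have hρ0 : ρ ≠ 0 := by
    intro h
    rw [h, Complex.zero_re] at h0
    exact lt_irrefl _ h0
  have hρ1 : ρ - 1 ≠ 0 := by
    intro h
    rw [sub_eq_zero.1 h, Complex.one_re] at h1'
    exact lt_irrefl _ h1'
  have h1 : weilMellin g ρ ≠ 0 := by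
    intro h
    have := hpos ρ.re
    rw [show (ρ.re : ℂ) + ρ.im * I = ρ from Complex.re_add_im ρ, h, Complex.zero_re] at this
    exact lt_irrefl _ this
  have h2 : weilMellin g (1 - conj ρ) ≠ 0 := by
    intro h
    have := hpos (1 - ρ.re)
    rw [show ((1 - ρ.re : ℝ) : ℂ) + ρ.im * I = 1 - conj ρ from ?_, h, Complex.zero_re] at this
    · exact lt_irrefl _ this
    · apply Complex.ext <;> simp
  rw [pairCoeff_poleKill hg, pairCoeff]
  exact mul_ne_zero (pow_ne_zero _ (mul_ne_zero hρ0 hρ1))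
    (mul_ne_zero h1 ((map_ne_zero _).2 h2))

/-! ## The pole-free criteria -/

/-- **Weil's criterion, pole-free form**: `RH ⟺ Re W(g ⋆ g̃) ≥ 0` for every smooth compactly
supported `g` with `ĝ(0) = ĝ(1) = 0`. The class is dipole-stable (`poleFree_translateMix`) and
detects every zero through `φ'' − φ/4` (`exists_pairCoeff_poleKill_ne_zero`).
[cite: Bombieri2000Weil, Thms. 1–2] -/
theorem riemannHypothesis_iff_poleFree :
    RiemannHypothesis ↔ ∀ g : ℝ → ℂ, IsWeilTest g →
      weilMellin g 0 = 0 → weilMellin g 1 = 0 → 0 ≤ (weilQuadratic g).re := by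
  constructor
  · intro h g hg _ _
    exact weil_criterion_holds.1 h g hg
  · intro H
    refine riemannHypothesis_of_stable_class
      (P := fun g ↦ weilMellin g 0 = 0 ∧ weilMellin g 1 = 0)
      (fun g c x hg hp ↦ poleFree_translateMix hg hp c x) (fun g hg hp ↦ H g hg hp.1 hp.2)
      fun ρ hρ ↦ ?_
    obtain ⟨φ, hφ, hne⟩ := exists_pairCoeff_poleKill_ne_zero hρ
    exact ⟨_, isWeilTest_poleKill hφ, poleFree_poleKill hφ, hne⟩

/-- On a pole-free test the pole form vanishes: `P(g) = 0`. [cite: Yoshida1992, §6 eq. (6.2)] -/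
theorem weilPoleForm_eq_zero_of_poleFree {g : ℝ → ℂ} (hg : IsWeilTest g)
    (h0 : weilMellin g 0 = 0) : weilPoleForm g = 0 := by
  rw [← two_mul_re_weilMellin_zero_mul_conj_one hg, h0, zero_mul, Complex.zero_re, mul_zero]

end Literature.NumberTheory.LFunctions.WeilPoleFree

end Part2

/-!
## Part 3 — port of `Summits/RiemannHypothesis/RiemannHypothesis/Theorems/SoloInformedScrewRayleigh.lean` (1 declarations kept)

# Commutativity of the test-function convolution (one helper)

`weilConv_comm` — Mathlib's `convolution_flip` transported to the tree's `weilConv`.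
-/

section Part3

open _root_.Complex _root_.Set _root_.MeasureTheory _root_.Filter _root_.Topology Literature.NumberTheory.LFunctions
open scoped ComplexConjugate

namespace Literature.NumberTheory.LFunctions.WeilPoleFree

/-! ## Convolution algebra for `weilConv` -/

/-- Commutativity of `weilConv` (no hypotheses; Mathlib `convolution_flip`).
[cite: Bombieri2000Weil, §3 (commutativity of the test-function convolution; helper)] -/
theorem weilConv_comm (f g : ℝ → ℂ) : weilConv f g = weilConv g f := by
  have h := convolution_flip (L := ContinuousLinearMap.mul ℂ ℂ) (μ := (volume : Measure ℝ))
    (f := f) (g := g)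
  rw [ContinuousLinearMap.flip_mul] at h
  exact h.symm

end Literature.NumberTheory.LFunctions.WeilPoleFree

end Part3

/-!
## Part 4 — port of `Summits/RiemannHypothesis/RiemannHypothesis/Theorems/SoloInformedWeilSurface.lean` (5 declarations kept)

# Reduction of Weil positivity to real-valued tests

For real-valued tests `u, v` the cross terms cancel exactly: `Q(u + iv) = Q(u) + Q(v)`
(`weilQuadratic_add_mul_I_of_real`; `W` is even, `weilFunctional_comp_neg`,
`weilFunctional_weilConv_weilReflect_swap_of_real`), the real and imaginary parts of a test are tests
(`isWeilTest_ofReal_re`, `isWeilTest_ofReal_im`), and `Re Q(g) = Re Q(Re g) + Re Q(Im g)`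
(`re_weilQuadratic_eq_re_add_im`).  (The source module's "Weil surface" typing of the Riemann–Roch proof shape is not
re-homed here.)  Reference: [Bombieri2000Weil, Thm. 2 (p. 193)].
-/

section Part4

open _root_.Complex _root_.Set _root_.MeasureTheory Literature.NumberTheory.LFunctions
open scoped ComplexConjugate

namespace Literature.NumberTheory.LFunctions.WeilPoleFree

/-! ## Weil positivity reduces to real-valued test functions -/

section RealReduction

variable {g u v : ℝ → ℂ}

/-- For real-valued `u, v` the two cross kernels have the same Weil functional:
`W(v ⋆ ũ) = W(u ⋆ ṽ)` (`v ⋆ ũ = ũ ⋆ v = (u ⋆ ṽ)(-·)` since `ũ = u(-·)`, `v = ṽ(-·)`, and `W` is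
even, `weilFunctional_comp_neg`).  Hypothesis-free beyond reality.
[cite: Bombieri2000Weil, Thm. 2 (reduction of Weil positivity to real-valued tests: Q(u + iv) = Q(u) + Q(v))] -/
theorem weilFunctional_weilConv_weilReflect_swap_of_real (hu : ∀ t, conj (u t) = u t)
    (hv : ∀ t, conj (v t) = v t) :
    weilFunctional (weilConv v (weilReflect u)) = weilFunctional (weilConv u (weilReflect v)) := by
  have hU : weilReflect u = fun t ↦ u (-t) := funext fun t ↦ by simp only [weilReflect, hu]
  have hV : v = fun t ↦ weilReflect v (-t) := funext fun t ↦ by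
    simp only [weilReflect, neg_neg, hv]
  rw [weilConv_comm v, hU]
  conv_lhs => rw [hV]
  rw [weilConv_comp_neg u (weilReflect v), weilFunctional_comp_neg]

/-- **Real and imaginary parts decouple in `Q`**: for real-valued test functions `u, v`,
`Q(u + i v) = Q(u) + Q(v)`.  Polarisation (`weilQuadratic_add`) gives the cross terms
`W(u ⋆ (iv)̃) + W((iv) ⋆ ũ) = -i W(u ⋆ ṽ) + i W(v ⋆ ũ) = 0` by the previous lemma, and
`Q(iv) = |i|² Q(v)`.
[cite: Bombieri2000Weil, Thm. 2 (reduction of Weil positivity to real-valued tests: Q(u + iv) = Q(u) + Q(v))] -/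
theorem weilQuadratic_add_mul_I_of_real (hu : IsWeilTest u) (hv : IsWeilTest v)
    (hur : ∀ t, conj (u t) = u t) (hvr : ∀ t, conj (v t) = v t) :
    weilQuadratic (u + fun t ↦ I * v t) = weilQuadratic u + weilQuadratic v := by
  have hIv : IsWeilTest (fun t ↦ I * v t) := hv.const_mul I
  have hR : weilReflect (fun t ↦ I * v t) = fun t ↦ (-I) * weilReflect v t := by
    rw [weilReflect_const_mul, conj_I]
  have hII : ∀ k : ℝ → ℂ, (fun t ↦ I * ((-I) * k t)) = k := fun k ↦ funext fun t ↦ by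
    rw [← mul_assoc, mul_neg, I_mul_I, neg_neg, one_mul]
  have hQ : weilQuadratic (fun t ↦ I * v t) = weilQuadratic v := by
    unfold weilQuadratic
    rw [hR, weilConv_const_mul_left, weilConv_const_mul_right]
    exact congrArg weilFunctional (hII _)
  have hT1 : weilFunctional (weilConv u (weilReflect fun t ↦ I * v t)) =
      -I * weilFunctional (weilConv u (weilReflect v)) := by
    rw [hR, weilConv_const_mul_right, weilFunctional_const_mul]
  have hT2 : weilFunctional (weilConv (fun t ↦ I * v t) (weilReflect u)) =
      I * weilFunctional (weilConv u (weilReflect v)) := by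
    rw [weilConv_const_mul_left, weilFunctional_const_mul,
      weilFunctional_weilConv_weilReflect_swap_of_real hur hvr]
  rw [weilQuadratic_add hu hIv, hQ, hT1, hT2]
  ring

/-- The real part of a test function (as a complex-valued function) is a test function.
[cite: Bombieri2000Weil, Thm. 2 (reduction of Weil positivity to real-valued tests: Q(u + iv) = Q(u) + Q(v))] -/
theorem isWeilTest_ofReal_re (hg : IsWeilTest g) : IsWeilTest fun t ↦ (((g t).re : ℝ) : ℂ) :=
  ⟨ofRealCLM.contDiff.comp (reCLM.contDiff.comp hg.1),
    hg.2.comp_left (g := fun z : ℂ ↦ ((z.re : ℝ) : ℂ)) (by simp)⟩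

/-- The imaginary part of a test function (as a complex-valued function) is a test function.
[cite: Bombieri2000Weil, Thm. 2 (reduction of Weil positivity to real-valued tests: Q(u + iv) = Q(u) + Q(v))] -/
theorem isWeilTest_ofReal_im (hg : IsWeilTest g) : IsWeilTest fun t ↦ (((g t).im : ℝ) : ℂ) :=
  ⟨ofRealCLM.contDiff.comp (imCLM.contDiff.comp hg.1),
    hg.2.comp_left (g := fun z : ℂ ↦ ((z.im : ℝ) : ℂ)) (by simp)⟩

/-- `Re Q(g) = Re Q(Re g) + Re Q(Im g)` for every test function `g`.
[cite: Bombieri2000Weil, Thm. 2 (reduction of Weil positivity to real-valued tests: Q(u + iv) = Q(u) + Q(v))] -/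
theorem re_weilQuadratic_eq_re_add_im (hg : IsWeilTest g) :
    (weilQuadratic g).re =
      (weilQuadratic fun t ↦ (((g t).re : ℝ) : ℂ)).re + (weilQuadratic fun t ↦ (((g t).im : ℝ) : ℂ)).re := by
  have hsplit : g = (fun t ↦ (((g t).re : ℝ) : ℂ)) + fun t ↦ I * (((g t).im : ℝ) : ℂ) := by
    funext t
    simp only [Pi.add_apply]
    rw [mul_comm]
    exact (re_add_im (g t)).symm
  conv_lhs => rw [hsplit]
  rw [weilQuadratic_add_mul_I_of_real (isWeilTest_ofReal_re hg) (isWeilTest_ofReal_im hg) (fun t ↦ conj_ofReal _)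
    (fun t ↦ conj_ofReal _), add_re]

end RealReduction

end Literature.NumberTheory.LFunctions.WeilPoleFree

end Part4

/-!
## Part 5 — port of `Summits/RiemannHypothesis/RiemannHypothesis/Theorems/MotivicDoorCC2019Criterion.lean` (4 declarations kept)

# Connes–Consani 2019 eq. (15) holds

The named fact `Literature.NumberTheory.ConnesConsani2019.eq15` —
`RiemannHypothesis ↔ (∀ f real test on ℝ₊^*, ∫ f d^*u = ∫ f du = 0 → 𝔰(f,f) ≤ 0)`
(A. Connes, C. Consani, *The Riemann–Roch strategy*, arXiv:1805.10501, §3.1 eq. (15): "It is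
known ([B3]) that RH is equivalent to the inequality …") — from the Parts above, with no hypothesis:

* `riemannHypothesis_iff_poleFree` (Part 2): `RH ⟺ Re Q(g) ≥ 0` for every complex test `g` with `ĝ(0) = ĝ(1) = 0`;
* the reduction to real tests (Part 4), plus the splitting `ĝ(s) = (Re g)^(s) + i (Im g)^(s)` proved here;
* the PROVED normalisation dictionary of `Literature/NumberTheory/ConnesConsani2019/RiemannRochStrategy.lean`:
  `2 𝔰(f,f) = weilPoleForm g − Re Q(g)` for `f = toMul u`, `g = u` real (`two_mul_ccPairing_toMul_eq`),
  `ĝ(0) = ∫ f d^*u`, `ĝ(1) = ∫ f du`.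

So `criterion_iff_real_poleFree : Criterion ↔ (pole-free positivity over real tests)` and `eq15_holds : eq15` (exact-name twin in
the last Part).  Nothing here is progress on RH: (15) is Bombieri's form of Weil's criterion; what the file certifies is that the
tree's reading of CC's `𝔰`, `N`, masses and test class is the one under which (15) is a theorem (the factor `½` and the constant
`c = ½(log π + γ)` included).

References: Connes–Consani 2019 §3.1 [ConnesConsani2019RiemannRochStrategy]; E. Bombieri, *Remarks on
Weil's quadratic functional I*, Rend. Mat. Acc. Lincei 11 (2000), Thm. 2 [Bombieri2000Weil].
-/

section Part5

namespace Literature.NumberTheory.LFunctions.WeilPoleFree.ConnesConsani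

open _root_.Complex _root_.Set _root_.MeasureTheory
open Literature.NumberTheory.LFunctions Literature.NumberTheory.ConnesConsani2019

/-- The Connes–Consani criterion (15), transported to the additive line, is exactly
pole-free Weil positivity over REAL test functions.
[cite: ConnesConsani2019RiemannRochStrategy, §3.1 eq. (15) p. 10 (RH ⟺ 𝔰(f,f) ≤ 0 for real tests with both masses zero; Bombieri’s form of Weil’s criterion)] -/
theorem criterion_iff_real_poleFree :
    Criterion ↔ ∀ u : ℝ → ℝ, IsWeilTest (fun t ↦ (u t : ℂ)) →
      weilMellin (fun t ↦ (u t : ℂ)) 0 = 0 → weilMellin (fun t ↦ (u t : ℂ)) 1 = 0 →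
        0 ≤ (weilQuadratic fun t ↦ (u t : ℂ)).re := by
  unfold Criterion
  refine forall₂_congr fun u hu ↦ ?_
  rw [weilMellin_zero_eq_massDstar, weilMellin_one_eq_massDu, Complex.ofReal_eq_zero,
    Complex.ofReal_eq_zero]
  refine imp_congr_right fun h0 ↦ imp_congr_right fun _ ↦ ?_
  have h2 := two_mul_ccPairing_toMul_eq hu
  have hP : weilPoleForm (fun t ↦ (u t : ℂ)) = 0 :=
    weilPoleForm_eq_zero_of_poleFree hu (by rw [weilMellin_zero_eq_massDstar, h0]; simp)
  rw [hP] at h2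
  constructor <;> intro h <;> linarith

/-- Splitting `ĝ(s)` into the transforms of the real and imaginary parts of `g`.
[cite: ConnesConsani2019RiemannRochStrategy, §3.1 eq. (15) p. 10 (RH ⟺ 𝔰(f,f) ≤ 0 for real tests with both masses zero; Bombieri’s form of Weil’s criterion)] -/
theorem weilMellin_eq_re_add_I_mul_im {g : ℝ → ℂ} (hg : IsWeilTest g) (s : ℂ) :
    weilMellin g s = weilMellin (fun t ↦ (((g t).re : ℝ) : ℂ)) s +
      I * weilMellin (fun t ↦ (((g t).im : ℝ) : ℂ)) s := by
  have hgr := isWeilTest_ofReal_re hg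
  have hgi := (isWeilTest_ofReal_im hg).const_mul I
  have hsplit : g = (fun t ↦ (((g t).re : ℝ) : ℂ)) + fun t ↦ I * (((g t).im : ℝ) : ℂ) := by
    funext t; simp only [Pi.add_apply]; rw [mul_comm]; exact (Complex.re_add_im (g t)).symm
  conv_lhs => rw [hsplit]
  rw [weilMellin_add hgr.1.continuous hgr.2 hgi.1.continuous hgi.2 s, weilMellin_const_mul]

/-- For `g` a test function with `ĝ(n) = 0` (`n = 0` or `1` encoded through the two real
transport lemmas): the real and imaginary parts have vanishing transform there too.
[cite: ConnesConsani2019RiemannRochStrategy, §3.1 eq. (15) p. 10 (RH ⟺ 𝔰(f,f) ≤ 0 for real tests with both masses zero; Bombieri’s form of Weil’s criterion)] -/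
theorem weilMellin_re_im_eq_zero {g : ℝ → ℂ} (hg : IsWeilTest g) {s : ℂ} {a b : ℝ}
    (ha : weilMellin (fun t ↦ (((g t).re : ℝ) : ℂ)) s = (a : ℂ))
    (hb : weilMellin (fun t ↦ (((g t).im : ℝ) : ℂ)) s = (b : ℂ)) (h : weilMellin g s = 0) :
    weilMellin (fun t ↦ (((g t).re : ℝ) : ℂ)) s = 0 ∧
      weilMellin (fun t ↦ (((g t).im : ℝ) : ℂ)) s = 0 := by
  rw [weilMellin_eq_re_add_I_mul_im hg s, ha, hb] at h
  have hre := congrArg Complex.re h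
  have him := congrArg Complex.im h
  simp at hre him
  rw [ha, hb, hre, him]
  simp

/-- **CC2019 eq. (15) holds**: RH ⟺ `𝔰(f,f) ≤ 0` for all real test `f` with both masses
zero — from the in-tree `riemannHypothesis_iff_poleFree` and the reduction to real tests.
[cite: ConnesConsani2019RiemannRochStrategy, §3.1 eq. (15) p. 10 (RH ⟺ 𝔰(f,f) ≤ 0 for real tests with both masses zero; Bombieri’s form of Weil’s criterion)] -/
theorem eq15_holds : eq15 := by
  rw [eq15, riemannHypothesis_iff_poleFree,
    criterion_iff_real_poleFree]
  constructor
  · exact fun H u hu h0 h1 ↦ H _ hu h0 h1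
  · intro H g hg h0 h1
    have hgr := isWeilTest_ofReal_re hg
    have hgi := isWeilTest_ofReal_im hg
    obtain ⟨hr0, hi0⟩ := weilMellin_re_im_eq_zero hg
      (weilMellin_zero_eq_massDstar fun t ↦ (g t).re) (weilMellin_zero_eq_massDstar fun t ↦ (g t).im) h0
    obtain ⟨hr1, hi1⟩ := weilMellin_re_im_eq_zero hg
      (weilMellin_one_eq_massDu fun t ↦ (g t).re) (weilMellin_one_eq_massDu fun t ↦ (g t).im) h1
    rw [re_weilQuadratic_eq_re_add_im hg]
    exact add_nonneg (H _ hgr hr0 hr1) (H _ hgi hi0 hi1)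

end Literature.NumberTheory.LFunctions.WeilPoleFree.ConnesConsani

end Part5

/-! ## Part 6 — the EXACT discharge `ConnesConsani2019.eq15_holds` -/

namespace Literature.NumberTheory.ConnesConsani2019

/-- **The named fact `eq15` HOLDS** (`RiemannRochStrategy.lean`; Connes–Consani 2019 §3.1 eq. (15), Bombieri's form of Weil's
criterion: `RiemannHypothesis ↔ Criterion`).  EXACT-name restatement of
`Literature.NumberTheory.LFunctions.WeilPoleFree.ConnesConsani.eq15_holds` (Part 5), Literature-side twin of
`Summit.RiemannHypothesis.RiemannHypothesis.Theorems.MotivicDoor.ConnesConsani.eq15_holds` (same proof).  A reformulation of RH;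
RH itself is untouched. [cite: ConnesConsani2019RiemannRochStrategy, §3.1 eq. (15) p. 10] [cite: Bombieri2000Weil, Thms. 1–2] -/
theorem eq15_holds : eq15 := Literature.NumberTheory.LFunctions.WeilPoleFree.ConnesConsani.eq15_holds

end Literature.NumberTheory.ConnesConsani2019

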